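import Mathlib.Topology.Algebra.Semigroup
import Mathlib.Order.Zorn
import Mathlib.Topology.Compactness.Compact
import Literature.Dynamics.TopologicalDynamics.UniformRecurrence
import HarnessLib

/-!
# Crux `RecurrentLiouville` (stmt-NavierStokesRegularity-1589), line `Sketch` v9 — harvest stub H1:
# the Auslander–Ellis theorem (abstract topological dynamics)

Helper file (theorems only).  **Auslander–Ellis theorem** (Auslander 1960; Ellis 1960; Furstenberg
1981, Ch. 8, Prop. 8.6 and Thm. 8.7): let an additive commutative monoid `G` of times act on a
compact Hausdorff space `X` by continuous maps `ϕ t`, with the action law `ϕ (s + t) = ϕ s ∘ ϕ t`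
(separate continuity only; neither joint continuity nor `ϕ 0 = id` is used).  Then every point `x`
is PROXIMAL to a UNIFORMLY RECURRENT point `y` of its orbit closure, proximality being expressed
without a uniformity: the orbit closure of the pair `(x, y)` under the diagonal action meets the
diagonal (`stub_prAuslanderEllis`).

## Proof (Ellis' enveloping semigroup and the Ellis–Numakura idempotent)

Work in `X → X` with the pointwise (product) topology — compact Hausdorff — and composition, for
which right composition `p ↦ p ∘ q` is continuous for every `q` and left composition `q ↦ f ∘ q`
is continuous for continuous `f` (a compact Hausdorff right-topological semigroup).
* `E := closure (range ϕ)`, the enveloping semigroup, is compact and closed under composition,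
  because `ϕ t ∘ ϕ s = ϕ (t + s)` (`prAE_comp_mem_envelope`); its elements map every point into its
  orbit closure (`prAE_apply_mem_closure_orbit`, evaluation at a point being continuous).
* Zorn's lemma downward — a chain of nonempty compact closed left ideals has nonempty intersection
  by Cantor's intersection theorem — gives a MINIMAL closed nonempty left ideal `I ⊆ E`, `E ∘ I ⊆ I`
  (`prAE_exists_minimal_leftIdeal`).
* `I` is a nonempty compact subsemigroup of `(X → X, ∘)`, so it contains an idempotent `v = v ∘ v`
  (Ellis–Numakura lemma: Mathlib's `exists_idempotent_in_compact_subsemigroup`).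
* `y := v x`.  Then `y ∈ closure (orbit x)`; the continuous map `p ↦ (p x, p y)` sends `range ϕ`
  onto the diagonal orbit of `(x, y)` and `v ∈ E` to `(v x, v (v x)) = (y, y)` — proximality; and
  `M := {q x | q ∈ I}` is compact, invariant (`ϕ t ∘ q ∈ I`), contains `y`, and `y` lies in the
  orbit closure of each of its points `q x`: the set `E ∘ q ⊆ I` is again a closed nonempty left
  ideal, hence equal to `I` by minimality, so `v = e ∘ q` with `e ∈ E` and
  `y = e (q x) ∈ closure (orbit (q x))`.  Birkhoff's finite-subcover argument (tree:
  `Literature.Dynamics.TopologicalDynamics.isUniformlyRecurrentPt_of_mem_closure_orbit`) then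
  makes `y` uniformly recurrent.

What is NOT here: the enveloping semigroup as a named object, proximality as a named relation,
distality, the converse statements (Furstenberg 1981, Ch. 8 §1–2); nothing here duplicates Mathlib
(which has the Ellis–Numakura lemma `exists_idempotent_of_compact_t2_of_continuous_mul_left` but no
enveloping semigroups, searched `Ellis`, `enveloping`, `proximal`).

## References

* J. Auslander, *On the proximal relation in topological dynamics*, Proc. Amer. Math. Soc. 11
  (1960) 890–895.
* R. Ellis, *A semigroup associated with a transformation group*, Trans. Amer. Math. Soc. 94
  (1960) 272–281.
* H. Furstenberg, *Recurrence in Ergodic Theory and Combinatorial Number Theory*, Princeton UP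
  (1981), Ch. 8, Prop. 8.6, Thm. 8.7; Ch. 1 §4, Thm. 1.15. [Furstenberg1981]
-/

-- the sub-problem namespace repeats the summit name (D-0017 layout `Summit.<S>.<P>.Theorems`)
set_option linter.dupNamespace false

namespace Summit.NavierStokesRegularity.NavierStokesRegularity.Theorems

open Set Filter Function Topology
open Literature.Dynamics.TopologicalDynamics

section prAE

variable {G X : Type*} [TopologicalSpace X]

/-! ### The right-topological semigroup `(X → X, ∘)` -/

/-- Left composition `q ↦ f ∘ q` with a CONTINUOUS map `f` is continuous for the pointwise
(product) topology on `X → X`. [folklore] -/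
private theorem prAE_continuous_comp_left {f : X → X} (hf : Continuous f) :
    Continuous fun q : X → X => f ∘ q :=
  continuous_pi fun a => hf.comp (continuous_apply a)

/-- Right composition `p ↦ p ∘ q` with ANY map `q` is continuous for the pointwise (product)
topology on `X → X`: `(X → X, ∘)` is a right-topological semigroup. [folklore] -/
private theorem prAE_continuous_comp_right (q : X → X) :
    Continuous fun p : X → X => p ∘ q :=
  continuous_pi fun a => continuous_apply (q a)

/-- Elements of the enveloping semigroup `closure (range ϕ)` map each point into its orbit closure:
evaluation at `x` is continuous on `X → X` and maps `range ϕ` onto the orbit of `x`.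
[cite: Furstenberg1981, Ch. 8, Prop. 8.6] -/
private theorem prAE_apply_mem_closure_orbit {ϕ : G → X → X} {p : X → X}
    (hp : p ∈ closure (range ϕ)) (x : X) : p x ∈ closure (range fun t => ϕ t x) := by
  have h : MapsTo (fun q : X → X => q x) (range ϕ) (range fun t => ϕ t x) := by
    rintro _ ⟨t, rfl⟩
    exact ⟨t, rfl⟩
  exact h.closure (continuous_apply x) hp

/-! ### The enveloping semigroup `E = closure (range ϕ)` -/

variable [AddCommMonoid G] {ϕ : G → X → X}

/-- The enveloping semigroup `closure (range ϕ)` is stable under left composition with each `ϕ t`: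
the set `{q | ϕ t ∘ q ∈ closure (range ϕ)}` is closed (left composition with the continuous `ϕ t`
is continuous) and contains `range ϕ`, because `ϕ t ∘ ϕ s = ϕ (t + s)`.
[cite: Furstenberg1981, Ch. 8, Thm. 8.7] -/
private theorem prAE_act_comp_mem_envelope (hcont : ∀ t, Continuous (ϕ t))
    (hadd : ∀ s t x, ϕ (s + t) x = ϕ s (ϕ t x)) (t : G) {q : X → X}
    (hq : q ∈ closure (range ϕ)) : ϕ t ∘ q ∈ closure (range ϕ) := by
  have h : MapsTo (fun q : X → X => ϕ t ∘ q) (range ϕ) (range ϕ) := by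
    rintro _ ⟨s, rfl⟩
    exact ⟨t + s, funext fun x => hadd t s x⟩
  exact h.closure (prAE_continuous_comp_left (hcont t)) hq

/-- The enveloping semigroup `closure (range ϕ)` is closed under composition: for fixed
`q ∈ closure (range ϕ)` the continuous right composition `p ↦ p ∘ q` maps `range ϕ` into the closed
set `closure (range ϕ)` (previous lemma), hence also its closure.
[cite: Furstenberg1981, Ch. 8, Thm. 8.7] -/
private theorem prAE_comp_mem_envelope (hcont : ∀ t, Continuous (ϕ t))
    (hadd : ∀ s t x, ϕ (s + t) x = ϕ s (ϕ t x)) {p q : X → X}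
    (hp : p ∈ closure (range ϕ)) (hq : q ∈ closure (range ϕ)) :
    p ∘ q ∈ closure (range ϕ) := by
  have h : MapsTo (fun p : X → X => p ∘ q) (range ϕ) (closure (range ϕ)) := by
    rintro _ ⟨t, rfl⟩
    exact prAE_act_comp_mem_envelope hcont hadd t hq
  exact h.closure_left (prAE_continuous_comp_right q) isClosed_closure hp

/-- **Minimal closed left ideals of the enveloping semigroup exist.**  On a compact phase space
there is a closed nonempty set `I ⊆ E = closure (range ϕ)` with `E ∘ I ⊆ I` which is minimal
among such sets.  Proof: Zorn's lemma downward; a chain of closed nonempty left ideals has as lower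
bound its intersection, nonempty by Cantor's intersection theorem (no separation axiom needed:
`IsCompact.nonempty_sInter_of_directed_nonempty_isCompact_isClosed`).
[cite: Furstenberg1981, Ch. 8, Prop. 8.6] -/
private theorem prAE_exists_minimal_leftIdeal [CompactSpace X] (hcont : ∀ t, Continuous (ϕ t))
    (hadd : ∀ s t x, ϕ (s + t) x = ϕ s (ϕ t x)) :
    ∃ I : Set (X → X), IsClosed I ∧ I.Nonempty ∧ I ⊆ closure (range ϕ) ∧
      (∀ p ∈ closure (range ϕ), ∀ q ∈ I, p ∘ q ∈ I) ∧
      ∀ J ⊆ I, IsClosed J → J.Nonempty → (∀ p ∈ closure (range ϕ), ∀ q ∈ J, p ∘ q ∈ J) →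
        J = I := by
  -- the Zorn family of closed nonempty left ideals of `E`
  set 𝓛 : Set (Set (X → X)) := {L | IsClosed L ∧ L.Nonempty ∧ L ⊆ closure (range ϕ) ∧
    ∀ p ∈ closure (range ϕ), ∀ q ∈ L, p ∘ q ∈ L}
  have hE : closure (range ϕ) ∈ 𝓛 :=
    ⟨isClosed_closure, ⟨ϕ 0, subset_closure (mem_range_self (0 : G))⟩, Subset.rfl,
      fun p hp q hq => prAE_comp_mem_envelope hcont hadd hp hq⟩
  -- chains have lower bounds
  have hchain : ∀ c ⊆ 𝓛, IsChain (· ⊆ ·) c → c.Nonempty → ∃ lb ∈ 𝓛, ∀ s ∈ c, lb ⊆ s := by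
    intro c hc𝓛 hc hcne
    refine ⟨⋂₀ c, ⟨?_, ?_, ?_, ?_⟩, fun s hs => sInter_subset_of_mem hs⟩
    · exact isClosed_sInter fun L hL => (hc𝓛 hL).1
    · haveI : Nonempty c := hcne.to_subtype
      exact IsCompact.nonempty_sInter_of_directed_nonempty_isCompact_isClosed
        (IsChain.directedOn hc.symm) (fun L hL => (hc𝓛 hL).2.1)
        (fun L hL => (hc𝓛 hL).1.isCompact) fun L hL => (hc𝓛 hL).1
    · obtain ⟨L, hL⟩ := hcne
      exact (sInter_subset_of_mem hL).trans (hc𝓛 hL).2.2.1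
    · intro p hp q hq
      exact mem_sInter.2 fun L hL => (hc𝓛 hL).2.2.2 p hp q (mem_sInter.1 hq L hL)
  obtain ⟨I, -, hImin⟩ := zorn_superset_nonempty 𝓛 hchain _ hE
  obtain ⟨hIcl, hIne, hIE, hIideal⟩ := hImin.prop
  exact ⟨I, hIcl, hIne, hIE, hIideal, fun J hJI hJcl hJne hJideal =>
    hImin.eq_of_subset ⟨hJcl, hJne, hJI.trans hIE, hJideal⟩ hJI⟩

end prAE

/-! ### The Auslander–Ellis theorem -/

/-- **AUSLANDER–ELLIS THEOREM.**  Let an additive commutative monoid of times act on a compact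
Hausdorff space by continuous maps with the action law `ϕ (s + t) = ϕ s ∘ ϕ t`.  Then every point
`x` is PROXIMAL to some UNIFORMLY RECURRENT point `y` of its orbit closure: the orbit closure of the
pair `(x, y)` under the diagonal action meets the diagonal.  Proof (Ellis): the enveloping semigroup
`E = closure (range ϕ)` in `X → X` is a compact Hausdorff right-topological semigroup; a minimal
closed left ideal `I` (`prAE_exists_minimal_leftIdeal`) carries an idempotent `v` (Ellis–Numakura,
`exists_idempotent_in_compact_subsemigroup`); `y := v x` works: `I x` is compact, invariant and each
of its points has `y` in its orbit closure (minimality of `I`), so `y` is uniformly recurrent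
(`isUniformlyRecurrentPt_of_mem_closure_orbit`), and `(v x, v y) = (y, y)` with `v ∈ closure
(range ϕ)` gives proximality. [cite: Furstenberg1981, Ch. 8, Thm. 8.7] -/
theorem stub_prAuslanderEllis {G X : Type*} [AddCommMonoid G] [TopologicalSpace G]
    [TopologicalSpace X] [CompactSpace X] [T2Space X]
    {ϕ : G → X → X} (hcont : ∀ t, Continuous (ϕ t))
    (hadd : ∀ s t x, ϕ (s + t) x = ϕ s (ϕ t x)) (x : X) :
    ∃ y ∈ closure (range fun t => ϕ t x),
      IsUniformlyRecurrentPt ϕ y ∧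
        ∃ z : X, (z, z) ∈ closure (range fun t => (ϕ t x, ϕ t y)) := by
  -- a minimal closed left ideal `I` of the enveloping semigroup `E = closure (range ϕ)`
  obtain ⟨I, hIcl, hIne, hIE, hIideal, hImin⟩ := prAE_exists_minimal_leftIdeal hcont hadd
  have hϕE : ∀ t, ϕ t ∈ closure (range ϕ) := fun t => subset_closure (mem_range_self t)
  -- Ellis–Numakura: an idempotent `v ∈ I` for composition (a local semigroup structure on `X → X`)
  obtain ⟨v, hvI, hvv⟩ : ∃ v ∈ I, v ∘ v = v := by
    letI : Semigroup (X → X) := { mul := fun f g => f ∘ g, mul_assoc := fun _ _ _ => rfl }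
    exact exists_idempotent_in_compact_subsemigroup (fun r => prAE_continuous_comp_right r) I hIne
      hIcl.isCompact fun p hp q hq => hIideal p (hIE hp) q hq
  refine ⟨v x, prAE_apply_mem_closure_orbit (hIE hvI) x, ?_, v x, ?_⟩
  · -- uniform recurrence of `y = v x`: Birkhoff on the compact invariant set `M = I x`
    have hMc : IsCompact ((fun p : X → X => p x) '' I) :=
      hIcl.isCompact.image (continuous_apply x)
    have hMinv : ∀ t, MapsTo (ϕ t) ((fun p : X → X => p x) '' I) ((fun p : X → X => p x) '' I) := by
      rintro t _ ⟨q, hq, rfl⟩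
      exact ⟨ϕ t ∘ q, hIideal _ (hϕE t) q hq, rfl⟩
    refine isUniformlyRecurrentPt_of_mem_closure_orbit hcont hadd hMc hMinv ⟨v, hvI, rfl⟩ ?_
    rintro _ ⟨q, hq, rfl⟩
    -- `E ∘ q ⊆ I` is a closed nonempty left ideal, hence `= I` by minimality
    have hJ : (fun p : X → X => p ∘ q) '' closure (range ϕ) = I := by
      refine hImin _ ?_ ?_ ?_ ?_
      · rintro _ ⟨p, hp, rfl⟩
        exact hIideal p hp q hq
      · exact (isClosed_closure.isCompact.image (prAE_continuous_comp_right q)).isClosed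
      · exact ⟨_, ϕ 0, hϕE 0, rfl⟩
      · rintro p' hp' _ ⟨p, hp, rfl⟩
        exact ⟨p' ∘ p, prAE_comp_mem_envelope hcont hadd hp' hp, rfl⟩
    -- so `v = e ∘ q` with `e ∈ E`, and `y = e (q x)` lies in the orbit closure of `q x`
    obtain ⟨e, he, hev⟩ : v ∈ (fun p : X → X => p ∘ q) '' closure (range ϕ) := by
      rw [hJ]
      exact hvI
    rw [← hev]
    exact prAE_apply_mem_closure_orbit he (q x)
  · -- proximality: `p ↦ (p x, p y)` maps `E` into the diagonal orbit closure and `v ↦ (y, y)`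
    have h : MapsTo (fun p : X → X => (p x, p (v x))) (range ϕ)
        (range fun t => (ϕ t x, ϕ t (v x))) := by
      rintro _ ⟨t, rfl⟩
      exact ⟨t, rfl⟩
    have hv := h.closure ((continuous_apply x).prodMk (continuous_apply (v x))) (hIE hvI)
    have hvx : v (v x) = v x := congrFun hvv x
    simpa only [hvx] using hv

end Summit.NavierStokesRegularity.NavierStokesRegularity.Theorems
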